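import Literature.MathematicalPhysics.QuantumLattice.XXZAntiferromagnetInfiniteVolumeOrder
import Literature.MathematicalPhysics.QuantumLattice.InfiniteVolumeTwistProofs
import Literature.MathematicalPhysics.QuantumLattice.InfiniteVolumeStatesDerivationProofs
import Literature.MathematicalPhysics.QuantumLattice.GibbsStationaritySlack
import HarnessLib

/-!
# The infinitesimal-field ground states of the Heisenberg antiferromagnet on `ℤ^d` ARE infinite-volume
# ground states (Bratteli–Robinson local criterion) — with Néel order

Koma–Tasaki, Commun. Math. Phys. **158** (1993) 191–214, §1: the infinitesimal-field state
`ω̃ = lim_{B↓0} lim_{Λ↑ℤ^d} ⟨·⟩_{Λ, H_Λ - BO_Λ}` (1.8) "applies to the ground state obtained by letting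
`β → ∞`"; Koma–Tasaki, J. Stat. Phys. **76** (1994) 745–803, §1: the infinite-volume ground states obtained
with an infinitesimal symmetry-breaking field are "the natural candidates for the physical ground states".
Bratteli–Robinson II, Def. 5.3.18 / Prop. 5.3.19 and §6.2.7; Tasaki (2020) App. A.7, Def. A.14, Lemma A.15:
an infinite-volume state `ω` of a quantum spin system is a **ground state** of the finite-range interaction
`Φ` iff `-i ω(A⋆ δ(A)) ≥ 0` for every local `A`, `δ(A) = i[H_{Λ'}, A]` (tree: `InfVolState.IsGroundState Φ R`,
`InfiniteVolumeStates.lean`), and thermodynamic limits of finite-volume ground states are ground states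
(Tasaki Lemma A.15; tree for BOX limits: `InfVolState.IsGroundState.of_isBoxLimitOf_holds`).

This file PROVES the torus / infinitesimal-field version for the Heisenberg model on `ℤ^d`:

* `heisenbergLatticeInteraction d n J : LatticeInteraction d (n + 1)` — the nearest-neighbour spin-`n/2`
  Heisenberg interaction `Φ {x, x + eᵢ} = J 𝐒_x·𝐒_{x+eᵢ}` on `ℤ^d` (the tree had the chain `d = 1` only,
  `heisenbergInteraction`), Hermitian (`isHermitian_heisenbergLatticeInteraction`) of finite range `1`
  (`hasFiniteRange_heisenbergLatticeInteraction`); its local Hamiltonians ARE the Heisenberg Hamiltonians of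
  the window graphs: `localHamiltonian ((heisenbergLatticeInteraction d n J).restrict Λ') univ =
  heisenbergHamiltonian n (windowGraph Λ') J` (`localHamiltonian_heisenbergLatticeInteraction_eq_windowGraph`).
* **`XXZKT.IsInfinitesimalFieldGroundState.isGroundState`**: for every `d, n, J` and every source direction
  `α`, every infinitesimal-field ground state `ω` of `XXZAntiferromagnetInfiniteVolumeOrder.lean` at `Δ = 1`
  (a weak-⋆ limit, `B_m ↓ 0`, of torus limits of the tracial ground states of `H_Λ - B_m O^α_Λ`) is an
  infinite-volume ground state of the Heisenberg interaction: `ω.IsGroundState (heisenbergLatticeInteraction d n J) 1`.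
* `isTranslationInvariant_heisenbergLatticeInteraction`; `heisenbergAF_not_hasUniqueGroundState`: for `J > 0`,
  `d ≥ 2`, `(d, S) ≠ (2, ½)` the Heisenberg antiferromagnet on `ℤ^d` does NOT have a unique infinite-volume ground
  state (a unique one would be translation invariant — tree `HasUniqueGroundState.shift_eq` — while the Néel state's
  staggered magnetisation alternates in sign along every bond, `latticeStagger_add_unitVec`).
* Hence (`heisenbergAF_exists_groundState_neelOrder`): for `J > 0`, `d ≥ 2`, `S = n/2 ≥ ½`, `(d, S) ≠ (2, ½)`
  THERE IS AN INFINITE-VOLUME GROUND STATE OF THE HEISENBERG ANTIFERROMAGNET ON `ℤ^d` WITH NÉEL ORDER: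
  `ω ∈ groundStates (heisenbergLatticeInteraction d n J) 1`, invariant under the even translations, with
  `(-1)^x Re ω(Sˣ_x) = m_s ≥ √3 σ > 0` at every site (`σ` the Kennedy–Lieb–Shastry / KT93 §7 long-range
  order parameter; the floor is `XXZKT.heisenbergAF_infiniteVolume_groundState_spontaneousStaggeredMagnetisation`).

Proof of the ground-state property (BR II Prop. 5.3.25 / Tasaki Lemma A.15, adapted to periodic boxes and a
vanishing source).  Fix a region `Λ`, `A ∈ 𝔄_Λ`, `Λ' = Λ_1` its `1`-neighbourhood, `Ã = A ⊗ 𝟙 ∈ 𝔄_{Λ'}`,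
`C = Ãᴴ[H_{Λ'}, Ã]`; we must show `ω(C) ≥ 0`.  (1) Locality on the torus (tree
`heisenbergTorus_commutator_spinEmbed`): pulled into a large even torus, `Γ(C) = Γ(Ã)ᴴ [H_L, Γ(Ã)]`, and
`H_L = K_L + B·O_L` with `K_L = H_L - BO_L` the sourced Hamiltonian.  (2) The tracial ground state `ρ_L` of
`K_L` has `ρ_L(Xᴴ[K_L, X]) = ρ_L(Xᴴ(K_L - E₀)X) ≥ 0` (tree `groundStateFunctional_conjTranspose_comm_mul_nonneg`).
(3) The source term is local: `Γ(Ã)ᴴ[O_L, Γ(Ã)] = Γ(D)` for the FIXED local observable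
`D = Σ_{y ∈ Λ'} (-1)^y Ãᴴ[S^α_y, Ã] ∈ 𝔄_{Λ'}` (spins outside the image of `Λ'` commute with `Γ(Ã)`; the torus
Néel sign at `y mod L` is `(-1)^y`, `L` even).  Hence along the defining tori `ρ_L(Γ C) - B ρ_L(Γ D) ≥ 0`, so
the sourced limit state has `ω_B(C) - B ω_B(D) ≥ 0`; as `B_m → 0`, `|ω_{B_m}(D)| ≤ ‖D‖` stays bounded and
`ω(C) = lim_m (ω_{B_m}(C) - B_m ω_{B_m}(D)) ≥ 0` (the cone `{z : 0 ≤ z}` of `ℂ` is closed).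

WHAT THIS IS NOT: no purity / uniqueness claim for these ground states; no statement at `B > 0` (the sourced
limit states are ground states of the SOURCED interaction, not formalised here); not the XXZ case `Δ ≠ 1` (the
torus locality lemma of the tree is for the Heisenberg Hamiltonian); nothing about the Hubbard model.

## References
* [KomaTasaki1993] T. Koma, H. Tasaki, CMP **158** (1993), §1 (1.8)–(1.10) and the sentence after Cor. 1.1.
* [KomaTasaki1994] T. Koma, H. Tasaki, J. Stat. Phys. **76** (1994), §1 (infinite-volume ground states with
  infinitesimal symmetry-breaking field).
* [BratteliRobinsonII1997] O. Bratteli, D. W. Robinson, *OAQSM 2*, Def. 5.3.18, Prop. 5.3.19, Prop. 5.3.25,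
  §6.2.1 eq. (6.2.4), §6.2.7.
* [Tasaki2020] H. Tasaki, *Physics and Mathematics of Quantum Many-Body Systems*, §2.4 eq. (2.4.1),
  App. A.7 Def. A.14, Lemma A.15.
* [KennedyLiebShastryJSP1988] T. Kennedy, E. H. Lieb, B. S. Shastry, J. Stat. Phys. **53** (1988) 1019.
-/

noncomputable section

namespace Literature.MathematicalPhysics.QuantumLattice

open Matrix Finset _root_.Filter Literature.Probability.LatticeModels
  Literature.MathematicalPhysics.QuantumLattice.SpinOperators
open scoped _root_.Topology ComplexOrder

variable {d : ℕ}

/-! ### The nearest-neighbour Heisenberg interaction on `ℤ^d` -/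

/-- **The spin-`n/2` Heisenberg interaction on `ℤ^d`** (coupling `J`): `Φ X = J 𝐒_x·𝐒_y` if `X = {x, y}` is a
nearest-neighbour bond `y = x + eᵢ`, and `0` otherwise (written, as the tree's chain interaction
`heisenbergInteraction`, as a double sum over `X` with the indicator of `y = x + eᵢ`, which selects the bond
exactly once). Tasaki (2020) §2.4, eq. (2.4.1); Bratteli–Robinson II §6.2.1 Example 6.2.? (Heisenberg model).
[cite: Tasaki2020, §2.4 eq. (2.4.1)] -/
def heisenbergLatticeInteraction (d n : ℕ) (J : ℝ) : LatticeInteraction d (n + 1) :=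
  LatticeInteraction.mk fun X =>
    if X.card = 2 then
      (J : ℂ) • ∑ x : ↥X, ∑ y : ↥X, if (∃ i : Fin d, (y : Site d) = x + unitVec i) then spinDot n x y else 0
    else 0

/-- Unfolding `heisenbergLatticeInteraction`. [cite: Tasaki2020, §2.4 eq. (2.4.1)] -/
theorem heisenbergLatticeInteraction_apply (n : ℕ) (J : ℝ) (X : Finset (Site d)) :
    heisenbergLatticeInteraction d n J X =
      if X.card = 2 then
        (J : ℂ) • ∑ x : ↥X, ∑ y : ↥X, if (∃ i : Fin d, (y : Site d) = x + unitVec i) then spinDot n x y else 0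
      else 0 :=
  rfl

/-- The Heisenberg interaction on `ℤ^d` is Hermitian. [cite: Tasaki2020, §2.4 eq. (2.4.1)] -/
theorem isHermitian_heisenbergLatticeInteraction (n : ℕ) (J : ℝ) :
    (heisenbergLatticeInteraction d n J).IsHermitian := by
  intro X
  rw [heisenbergLatticeInteraction_apply]
  split_ifs with h2
  · refine IsHermitian.smul ?_ ?_
    · rw [IsHermitian, conjTranspose_sum]
      refine Finset.sum_congr rfl fun x _ => ?_
      rw [conjTranspose_sum]
      refine Finset.sum_congr rfl fun y _ => ?_
      split_ifs
      · exact (spinDot_isHermitian n x y).eq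
      · exact conjTranspose_zero
    · rw [isSelfAdjoint_iff, Complex.star_def, Complex.conj_ofReal]
  · exact isHermitian_zero

/-- Nearest neighbours are at sup-distance `1`: `dist x (x + eᵢ) = 1`. [folklore] -/
private theorem dist_add_unitVec (x : Site d) (i : Fin d) : dist x (x + unitVec i) = 1 := by
  rw [dist_comm, dist_eq_norm, add_sub_cancel_left, Pi.norm_single, norm_one]

/-- **The Heisenberg interaction on `ℤ^d` has range `1`**: `Φ X = 0` whenever `diam X > 1`.
[cite: Tasaki2020, §2.4 eq. (2.4.1)] -/
theorem hasFiniteRange_heisenbergLatticeInteraction (n : ℕ) (J : ℝ) :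
    (heisenbergLatticeInteraction d n J).HasFiniteRange 1 := by
  intro X hX
  rw [heisenbergLatticeInteraction_apply]
  split_ifs with h2
  · rw [Finset.sum_eq_zero fun x _ => Finset.sum_eq_zero fun y _ => ?_, smul_zero]
    rw [if_neg]
    rintro ⟨i, hxy⟩
    have hdist : dist (x : Site d) y = 1 := by rw [hxy, dist_add_unitVec]
    have hne : (x : Site d) ≠ y := fun h => by
      rw [h, dist_self] at hdist
      exact zero_ne_one hdist
    have hXe : X = {(x : Site d), (y : Site d)} := by
      refine (Finset.eq_of_subset_of_card_le (fun z hz => ?_) ?_).symm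
      · rcases Finset.mem_insert.1 hz with rfl | hz
        · exact x.2
        · rw [Finset.mem_singleton.1 hz]; exact y.2
      · rw [Finset.card_pair hne, h2]
    rw [hXe, Finset.coe_pair, Metric.diam_pair, hdist] at hX
    exact lt_irrefl _ hX
  · rfl

/-- **The Heisenberg interaction on `ℤ^d` is translation invariant**: `Φ (X + v) = τ_v (Φ X)` (the bond
condition `y = x + eᵢ` is translation invariant; the chain case is the tree's
`isTranslationInvariant_heisenbergInteraction_holds`). [cite: BratteliRobinsonII1997, §6.2.1 eq. (6.2.3)] -/
theorem isTranslationInvariant_heisenbergLatticeInteraction (n : ℕ) (J : ℝ) :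
    (heisenbergLatticeInteraction d n J).IsTranslationInvariant := by
  intro v X
  rw [heisenbergLatticeInteraction_apply, heisenbergLatticeInteraction_apply, card_map]
  split_ifs with h2
  · simp only [transportOp_eq_reindexAlgEquiv, map_smul, map_sum]
    congr 1
    rw [← (finsetMapEquiv (Site.shift v).toEmbedding X).sum_comp]
    refine sum_congr rfl fun x _ ↦ ?_
    rw [← (finsetMapEquiv (Site.shift v).toEmbedding X).sum_comp]
    refine sum_congr rfl fun y _ ↦ ?_
    simp only [coe_finsetMapEquiv_apply, Equiv.coe_toEmbedding, Site.shift_apply,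
      add_right_comm _ v, add_left_inj]
    split_ifs
    · rw [← transportOp_eq_reindexAlgEquiv, transportOp_spinDot]
    · rw [map_zero]
  · rw [transportOp_eq_reindexAlgEquiv, map_zero]

/-- Double counting over two-element subsets: for `g` vanishing on the diagonal,
`Σ_{Y ⊆ s, #Y = 2} Σ_{x,y ∈ Y} g x y = Σ_{x,y ∈ s} g x y` (the tree's `sum_powerset_card_two_sum_sum` of
`InfiniteVolumeChainEnergyProofs.lean`, re-proved here because that module is not built on the hub). [folklore] -/
private theorem sum_powerset_card_two_sum_sum' {α M : Type*} [DecidableEq α] [AddCommMonoid M]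
    (s : Finset α) (g : α → α → M) (hg : ∀ x, g x x = 0) :
    ∑ Y ∈ s.powerset with Y.card = 2, ∑ x ∈ Y, ∑ y ∈ Y, g x y = ∑ x ∈ s, ∑ y ∈ s, g x y := by
  have key : ∀ Y ∈ s.powerset.filter (·.card = 2),
      ∑ x ∈ Y, ∑ y ∈ Y, g x y = ∑ x ∈ s, ∑ y ∈ s, if x ∈ Y ∧ y ∈ Y then g x y else 0 := by
    intro Y hY
    have hYs : Y ⊆ s := mem_powerset.1 (mem_filter.1 hY).1
    rw [← Finset.sum_subset hYs (f := fun x => ∑ y ∈ s, if x ∈ Y ∧ y ∈ Y then g x y else 0)]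
    · refine sum_congr rfl fun x hx => ?_
      rw [← Finset.sum_subset hYs]
      · exact sum_congr rfl fun y hy => by rw [if_pos ⟨hx, hy⟩]
      · intro y _ hy
        rw [if_neg fun h => hy h.2]
    · intro x _ hx
      exact sum_eq_zero fun y _ => by rw [if_neg fun h => hx h.1]
  rw [sum_congr rfl key, sum_comm]
  refine sum_congr rfl fun x hx => ?_
  rw [sum_comm]
  refine sum_congr rfl fun y hy => ?_
  rw [← sum_filter, sum_const]
  by_cases hxy : x = y
  · subst hxy
    rw [hg, smul_zero]
  · have hfilter : ((s.powerset.filter (·.card = 2)).filter fun Y => x ∈ Y ∧ y ∈ Y) = {{x, y}} := by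
      ext Y
      simp only [mem_filter, mem_powerset, mem_singleton]
      constructor
      · rintro ⟨⟨-, hcard⟩, hxY, hyY⟩
        obtain ⟨a, b, -, rfl⟩ := card_eq_two.1 hcard
        simp only [mem_insert, mem_singleton] at hxY hyY
        rcases hxY with rfl | rfl <;> rcases hyY with rfl | rfl
        · exact absurd rfl hxy
        · rfl
        · exact Finset.pair_comm _ _
        · exact absurd rfl hxy
      · rintro rfl
        refine ⟨⟨fun z hz => ?_, card_pair hxy⟩, mem_insert_self _ _,
          mem_insert_of_mem (mem_singleton_self _)⟩
        simp only [mem_insert, mem_singleton] at hz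
        rcases hz with rfl | rfl
        · exact hx
        · exact hy
    rw [hfilter, card_singleton, one_smul]

/-- **The local Hamiltonians of the Heisenberg interaction are bond sums**: for every finite `Λ' ⊆ ℤ^d`,
`H_{Λ'} = Σ_{Y ⊆ Λ'} Φ Y = J Σ_{x, y ∈ Λ', y = x + eᵢ} 𝐒_x·𝐒_y` (the chain case is the tree's
`localHamiltonian_heisenbergInteraction`). [cite: Tasaki2020, §2.4 eq. (2.4.1)] -/
theorem localHamiltonian_heisenbergLatticeInteraction (n : ℕ) (J : ℝ) (Λ' : Finset (Site d)) :
    localHamiltonian ((heisenbergLatticeInteraction d n J).restrict Λ') univ =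
      (J : ℂ) • ∑ x : ↥Λ', ∑ y : ↥Λ',
        if (∃ i : Fin d, (y : Site d) = x + unitVec i) then spinDot n x y else 0 := by
  classical
  set g : Site d → Site d → Op ↥Λ' (n + 1) := fun x y =>
    if hx : x ∈ Λ' then if hy : y ∈ Λ' then
      if (∃ i : Fin d, y = x + unitVec i) then spinDot n (⟨x, hx⟩ : ↥Λ') ⟨y, hy⟩ else 0 else 0 else 0 with hg
  have hgxx : ∀ x, g x x = 0 := fun x => by
    simp only [hg]
    by_cases hx : x ∈ Λ'
    · rw [dif_pos hx, dif_pos hx, if_neg]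
      rintro ⟨i, hi⟩
      exact self_ne_add_unitVec x i hi
    · rw [dif_neg hx]
  have hterm : ∀ Y ∈ Λ'.powerset,
      (if hY : Y ⊆ Λ' then embedOp hY (heisenbergLatticeInteraction d n J Y) else 0) =
        if Y.card = 2 then (J : ℂ) • ∑ x ∈ Y, ∑ y ∈ Y, g x y else 0 := by
    intro Y hY
    have hYs : Y ⊆ Λ' := mem_powerset.1 hY
    rw [dif_pos hYs, heisenbergLatticeInteraction_apply]
    split_ifs with h2
    · rw [embedOp_smul, embedOp_sum]
      congr 1
      rw [← Finset.sum_coe_sort Y]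
      refine sum_congr rfl fun x _ => ?_
      rw [embedOp_sum, ← Finset.sum_coe_sort Y]
      refine sum_congr rfl fun y _ => ?_
      simp only [hg, dif_pos (hYs x.2), dif_pos (hYs y.2)]
      split_ifs
      · exact embedOp_spinDot n hYs x y
      · exact embedOp_zero hYs
    · exact embedOp_zero hYs
  rw [localHamiltonian_restrict_eq_sum, sum_congr rfl hterm, ← sum_filter, ← smul_sum,
    sum_powerset_card_two_sum_sum' Λ' g hgxx, ← Finset.sum_coe_sort Λ']
  congr 1
  refine sum_congr rfl fun x _ => ?_
  rw [← Finset.sum_coe_sort Λ']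
  refine sum_congr rfl fun y _ => ?_
  simp only [hg, dif_pos x.2, dif_pos y.2]

/-- `eᵢ + eⱼ ≠ 0` in `ℤ^d`. [folklore] -/
private theorem unitVec_add_unitVec_ne_zero (i j : Fin d) : (unitVec i : Site d) + unitVec j ≠ 0 := by
  intro h
  have h1 := congrFun h i
  by_cases hij : i = j
  · subst hij
    simp [unitVec] at h1
  · simp [unitVec, Pi.single_eq_of_ne hij] at h1

/-- A bond is oriented exactly one way: `y = x + eᵢ` and `x = y + eⱼ` cannot both hold. [folklore] -/
private theorem not_both_orientations {x y : Site d} (h₁ : ∃ i : Fin d, y = x + unitVec i)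
    (h₂ : ∃ j : Fin d, x = y + unitVec j) : False := by
  obtain ⟨i, hi⟩ := h₁
  obtain ⟨j, hj⟩ := h₂
  refine unitVec_add_unitVec_ne_zero (d := d) i j ?_
  have h : x + (unitVec i + unitVec j) = x + 0 := by rw [← add_assoc, ← hi, ← hj, add_zero]
  exact add_left_cancel h

/-- **The Heisenberg Hamiltonian of a window graph as an oriented pair sum**:
`H_{windowGraph Λ'}(J) = J Σ_{x, y ∈ Λ', y = x + eᵢ} 𝐒_x·𝐒_y` (each bond `{x, x+eᵢ}` of the window is counted
once, with its orientation). [cite: Tasaki2020, §2.4 eq. (2.4.1)] -/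
theorem heisenbergHamiltonian_windowGraph_eq_sum (n : ℕ) (J : ℝ) (Λ' : Finset (Site d)) :
    heisenbergHamiltonian n (windowGraph Λ') J =
      (J : ℂ) • ∑ x : ↥Λ', ∑ y : ↥Λ',
        if (∃ i : Fin d, (y : Site d) = x + unitVec i) then spinDot n x y else 0 := by
  classical
  unfold heisenbergHamiltonian
  congr 1
  -- the oriented pairs
  set P : Finset (↥Λ' × ↥Λ') := univ.filter fun p => ∃ i : Fin d, (p.2 : Site d) = p.1 + unitVec i with hP
  have hsum : (∑ x : ↥Λ', ∑ y : ↥Λ',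
      if (∃ i : Fin d, (y : Site d) = x + unitVec i) then spinDot n x y else 0) =
      ∑ p ∈ P, spinDot n p.1 p.2 := by
    rw [hP, sum_filter, ← Finset.sum_product']
    rfl
  rw [hsum]
  symm
  refine Finset.sum_nbij (fun p => s(p.1, p.2)) ?_ ?_ ?_ ?_
  · intro p hp
    rw [hP, mem_filter] at hp
    obtain ⟨i, hi⟩ := hp.2
    rw [SimpleGraph.mem_edgeFinset, SimpleGraph.mem_edgeSet, windowGraph_adj]
    exact ⟨fun h => self_ne_add_unitVec (p.1 : Site d) i (by rw [← hi, h]), Or.inl ⟨i, hi⟩⟩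
  · intro p hp p' hp' h
    rw [hP, Finset.mem_coe, mem_filter] at hp hp'
    rcases Sym2.eq_iff.1 h with ⟨h1, h2⟩ | ⟨h1, h2⟩
    · exact Prod.ext h1 h2
    · exfalso
      refine not_both_orientations hp.2 ?_
      obtain ⟨j, hj⟩ := hp'.2
      exact ⟨j, by rw [h1, h2]; exact hj⟩
  · intro e he
    rw [Finset.mem_coe, SimpleGraph.mem_edgeFinset] at he
    induction e using Sym2.ind with
    | _ x y =>
      rw [SimpleGraph.mem_edgeSet, windowGraph_adj] at he
      rcases he.2 with h | h
      · exact ⟨(x, y), by rw [hP, Finset.mem_coe, mem_filter]; exact ⟨mem_univ _, h⟩, rfl⟩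
      · exact ⟨(y, x), by rw [hP, Finset.mem_coe, mem_filter]; exact ⟨mem_univ _, h⟩, Sym2.eq_swap⟩
  · intro p _
    rfl

/-- **The local Hamiltonians of the Heisenberg interaction on `ℤ^d` are the Heisenberg Hamiltonians of the
window graphs**: `Σ_{Y ⊆ Λ'} Φ Y = H_{windowGraph Λ'}(J)` for every finite `Λ' ⊆ ℤ^d`.
[cite: BratteliRobinsonII1997, §6.2.1 eq. (6.2.4)] -/
theorem localHamiltonian_heisenbergLatticeInteraction_eq_windowGraph (n : ℕ) (J : ℝ) (Λ' : Finset (Site d)) :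
    localHamiltonian ((heisenbergLatticeInteraction d n J).restrict Λ') univ =
      heisenbergHamiltonian n (windowGraph Λ') J := by
  rw [localHamiltonian_heisenbergLatticeInteraction, heisenbergHamiltonian_windowGraph_eq_sum]

/-! ### The `1`-neighbourhood contains the lattice neighbours -/

/-- `x + eᵢ ∈ Λ_1` and `x - eᵢ ∈ Λ_1` for `x ∈ Λ` (`Λ_1 = thicken Λ 1`). [cite: BratteliRobinsonII1997, §6.2.1] -/
theorem add_sub_unitVec_mem_thicken_one {Λ : Finset (Site d)} {x : Site d} (hx : x ∈ Λ) (i : Fin d) :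
    x + unitVec i ∈ thicken Λ 1 ∧ x - unitVec i ∈ thicken Λ 1 := by
  have hmem : ∀ v : Site d, (∀ j, -(1 : ℤ) ≤ v j ∧ v j ≤ 1) → x + v ∈ thicken Λ 1 := by
    intro v hv
    refine mem_biUnion.2 ⟨x, hx, mem_image.2 ⟨v, ?_, rfl⟩⟩
    rw [Nat.floor_one]
    exact mem_box.2 (by exact_mod_cast hv)
  have hb : ∀ j, -(1 : ℤ) ≤ (unitVec i : Site d) j ∧ (unitVec i : Site d) j ≤ 1 := fun j => by
    by_cases h : j = i
    · subst h; simp [unitVec]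
    · simp [unitVec, Pi.single_eq_of_ne h]
  refine ⟨hmem _ hb, ?_⟩
  rw [sub_eq_add_neg]
  exact hmem _ fun j => by have := hb j; simp only [Pi.neg_apply]; omega

/-- The isotropic point: `xxzHamiltonian n G J 1 = heisenbergHamiltonian n G J` (each edge term is `𝐒_x·𝐒_y`;
public version of a lemma several tree files keep private). [cite: Tasaki2020, §2.4 eq. (2.4.1)] -/
theorem xxzHamiltonian_at_one {V : Type*} [Fintype V] [DecidableEq V] (n : ℕ) (G : SimpleGraph V)
    [DecidableRel G.Adj] (J : ℝ) : xxzHamiltonian n G J 1 = heisenbergHamiltonian n G J := by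
  rw [xxzHamiltonian, heisenbergHamiltonian]
  congr 1
  refine sum_congr rfl fun e _ => ?_
  induction e using Sym2.ind with
  | h x y =>
    simp only [Sym2.lift_mk, spinDotSym_mk, spinDot, Fin.sum_univ_three, Complex.ofReal_one, one_smul]

/-! ### The source term is local: `Γ(Ã)ᴴ[O_L, Γ(Ã)] = Γ(D)` -/

namespace XXZKT

variable {L : ℕ} [NeZero L] (n : ℕ)

/-- **Commutator of the staggered spin with an embedded local observable**: for a site injection
`φ : ↥Λ' ↪ (ℤ/Lℤ)^d` and `B ∈ 𝔄_{Λ'}`, `O^α Γ_φ(B) - Γ_φ(B) O^α = Γ_φ(Σ_{y ∈ Λ'} (-1)^{φ y} (S^α_y B - B S^α_y))` — the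
spins off the range of `φ` commute with `Γ_φ(B)`. [cite: BratteliRobinsonII1997, §6.2.1 (local commutativity)] -/
theorem stagSpin_comm_spinEmbed {Λ' : Finset (Site d)} (φ : ↥Λ' ↪ TorusSite d L) (σ : TorusSite d L → ℕ)
    (α : Fin 3) (B : Op ↥Λ' (n + 1)) :
    stagSpin n σ α * spinEmbed φ B - spinEmbed φ B * stagSpin n σ α =
      spinEmbed φ (∑ y : ↥Λ', (stagSign σ (φ y) : ℂ) • (siteSpin n y α * B - B * siteSpin n y α)) := by
  classical
  rw [stagSpin, Finset.sum_mul, Finset.mul_sum, ← Finset.sum_sub_distrib, map_sum]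
  -- split the sites of the torus into the range of `φ` and its complement
  rw [← Finset.sum_add_sum_compl (rangeSites φ)]
  have hzero : ∑ z ∈ (rangeSites φ)ᶜ, ((stagSign σ z : ℂ) • siteSpin n z α * spinEmbed φ B -
      spinEmbed φ B * ((stagSign σ z : ℂ) • siteSpin n z α)) = 0 := by
    refine Finset.sum_eq_zero fun z hz => ?_
    rw [Finset.mem_compl] at hz
    have hc : Commute (spinEmbed φ B) (siteSpin n z α) :=
      spinEmbed_commute_of_disjoint φ B (isSupportedOn_onSite_holds z _)
        (Finset.disjoint_singleton_right.2 hz)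
    rw [Matrix.smul_mul, Matrix.mul_smul, hc.eq, sub_self]
  rw [hzero, add_zero, Finset.sum_map]
  refine Finset.sum_congr rfl fun y _ => ?_
  rw [map_smul, map_sub, map_mul, map_mul, spinEmbed_siteSpin, Matrix.smul_mul, Matrix.mul_smul, smul_sub]

/-- **The source commutator, conjugated, is the image of a FIXED local observable** (even torus, `φ` the
pull-back `x ↦ x mod L` on `Λ'`): `Γ(B)ᴴ (O^α Γ(B) - Γ(B) O^α) = Γ(Σ_{y ∈ Λ'} (-1)^y Bᴴ(S^α_y B - B S^α_y))` with
the Néel sign `(-1)^y` of `ℤ^d`. [cite: KomaTasaki1993, §1 (1.8)] -/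
theorem conjTranspose_mul_stagSpin_comm_spinEmbed (hL : Even L) {Λ' : Finset (Site d)}
    (h' : Set.InjOn (Torus.proj (d := d) L) ↑Λ') (α : Fin 3) (B : Op ↥Λ' (n + 1)) :
    (spinEmbed (spinToTorusEmb L h') B)ᴴ *
        (stagSpin n (torusParityExp d L) α * spinEmbed (spinToTorusEmb L h') B -
          spinEmbed (spinToTorusEmb L h') B * stagSpin n (torusParityExp d L) α) =
      spinEmbed (spinToTorusEmb L h')
        (∑ y : ↥Λ', (latticeStagger (y : Site d) : ℂ) • (Bᴴ * (siteSpin n y α * B - B * siteSpin n y α))) := by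
  rw [stagSpin_comm_spinEmbed, ← spinEmbed_conjTranspose, ← map_mul, Finset.mul_sum]
  congr 1
  refine Finset.sum_congr rfl fun y _ => ?_
  rw [Matrix.mul_smul, spinToTorusEmb_apply, stagSign_torusParityExp_proj hL]

/-! ### The infinitesimal-field ground states are infinite-volume ground states -/

open scoped Matrix.Norms.L2Operator in
/-- **THE INFINITESIMAL-FIELD GROUND STATES OF THE HEISENBERG ANTIFERROMAGNET ARE INFINITE-VOLUME GROUND STATES**
(Bratteli–Robinson local criterion `-i ω(A⋆δ(A)) ≥ 0`, tree `InfVolState.IsGroundState`, for the nearest-neighbour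
Heisenberg interaction on `ℤ^d` with range `1`).  For every `d, n, J`, every source direction `α` and every
`ω` with `IsInfinitesimalFieldGroundState d n J 1 α ω` (weak-⋆ limit as `B_m ↓ 0` of torus limits of the tracial
ground states of `H_Λ - B_m O^α_Λ`), `ω.IsGroundState (heisenbergLatticeInteraction d n J) 1`.
[cite: Tasaki2020, App. A.7 Lemma A.15] [cite: BratteliRobinsonII1997, Prop. 5.3.25 and §6.2.7] -/
theorem IsInfinitesimalFieldGroundState.isGroundState {n : ℕ} {J : ℝ} {α : Fin 3} {ω : InfVolState d (n + 1)}
    (h : IsInfinitesimalFieldGroundState d n J 1 α ω) :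
    ω.IsGroundState (heisenbergLatticeInteraction d n J) 1 := by
  classical
  intro Λ A
  set Λ' := thicken Λ (1 : ℝ) with hΛ'
  have hΛ : Λ ⊆ Λ' := subset_thicken Λ 1
  set At : Op ↥Λ' (n + 1) := embedOp hΛ A with hAt
  set H' : Op ↥Λ' (n + 1) := localHamiltonian ((heisenbergLatticeInteraction d n J).restrict Λ') univ with hH'
  -- the observable `C = Ãᴴ [H', Ã]` and the source observable `D`
  set C : Op ↥Λ' (n + 1) := Atᴴ * (H' * At - At * H') with hC
  set D : Op ↥Λ' (n + 1) :=
    ∑ y : ↥Λ', (latticeStagger (y : Site d) : ℂ) • (Atᴴ * (siteSpin n y α * At - At * siteSpin n y α)) with hD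
  -- the goal is `0 ≤ ω(C)`
  have hgoal : -Complex.I * ω.expect Λ' ((embedOp hΛ A)ᴴ * derivation (heisenbergLatticeInteraction d n J) 1 Λ A) =
      ω.expect Λ' C := by
    have hder : derivation (heisenbergLatticeInteraction d n J) 1 Λ A = Complex.I • (H' * At - At * H') := rfl
    rw [hder, Matrix.mul_smul, map_smul, smul_eq_mul, ← mul_assoc, ← hAt, ← hC]
    simp
  rw [hgoal]
  obtain ⟨B, ωB, hBpos, hB0, hωB, hlim⟩ := h
  -- Step A: at each `B_m`, `0 ≤ ω_m(C) - B_m ω_m(D)`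
  have hstep : ∀ m : ℕ, 0 ≤ (ωB m).expect Λ' C - (B m : ℂ) * (ωB m).expect Λ' D := by
    intro m
    obtain ⟨κ, hκ, hω⟩ := hωB m
    have hT : Tendsto (fun j => torusSpinExpect (2 * κ j + 2) Λ' C
        ((sourcedAF d (2 * κ j + 2) n J 1 α (B m)).groundStateFunctional) -
        (B m : ℂ) * torusSpinExpect (2 * κ j + 2) Λ' D
          ((sourcedAF d (2 * κ j + 2) n J 1 α (B m)).groundStateFunctional)) atTop
        (𝓝 ((ωB m).expect Λ' C - (B m : ℂ) * (ωB m).expect Λ' D)) :=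
      (hω Λ' C).sub ((hω Λ' D).const_mul _)
    refine ge_of_tendsto hT ?_
    filter_upwards [eventually_injOn_proj_of_tendsto Λ' (tendsto_two_mul_add_two hκ)] with j hj
    have hk : Even (2 * κ j + 2) := ⟨κ j + 1, by ring⟩
    set Lj := 2 * κ j + 2 with hLj
    set K := sourcedAF d Lj n J 1 α (B m) with hK
    set X := spinEmbed (spinToTorusEmb Lj hj) At with hX
    rw [torusSpinExpect_of_injOn hj, torusSpinExpect_of_injOn hj]
    -- locality on the torus: `Γ(C) = Xᴴ [H_L, X]`, `Γ(D) = Xᴴ [O_L, X]`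
    have hcomm : heisenbergHamiltonian n (torusGraph d Lj) J * X - X * heisenbergHamiltonian n (torusGraph d Lj) J =
        spinEmbed (spinToTorusEmb Lj hj) (H' * At - At * H') := by
      rw [hX, hAt, ← spinEmbed_siteIncl_eq_embedOp, hH',
        localHamiltonian_heisenbergLatticeInteraction_eq_windowGraph]
      exact heisenbergTorus_commutator_spinEmbed n J hΛ (fun x hx i => add_sub_unitVec_mem_thicken_one hx i) hj A
    have hΓC : spinEmbed (spinToTorusEmb Lj hj) C =
        Xᴴ * (heisenbergHamiltonian n (torusGraph d Lj) J * X - X * heisenbergHamiltonian n (torusGraph d Lj) J) := by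
      rw [hC, map_mul, spinEmbed_conjTranspose, hcomm]
    have hΓD : spinEmbed (spinToTorusEmb Lj hj) D =
        Xᴴ * (stagSpin n (torusParityExp d Lj) α * X - X * stagSpin n (torusParityExp d Lj) α) := by
      rw [hD, hX, conjTranspose_mul_stagSpin_comm_spinEmbed n hk hj α At]
    -- `H_L = K + B O`, so `Xᴴ[H_L,X] - B Xᴴ[O,X] = Xᴴ[K,X]`
    have hHK : heisenbergHamiltonian n (torusGraph d Lj) J = K + (B m : ℂ) • stagSpin n (torusParityExp d Lj) α := by
      rw [hK, sourcedAF, xxzHamiltonian_at_one, sub_add_cancel]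
    have hkey : spinEmbed (spinToTorusEmb Lj hj) C - (B m : ℂ) • spinEmbed (spinToTorusEmb Lj hj) D =
        Xᴴ * (K * X - X * K) := by
      rw [hΓC, hΓD, hHK]
      simp only [Matrix.add_mul, Matrix.mul_add, Matrix.smul_mul, Matrix.mul_smul, Matrix.mul_sub, smul_sub]
      abel
    have hval : K.groundStateFunctional (spinEmbed (spinToTorusEmb Lj hj) C) -
        (B m : ℂ) * K.groundStateFunctional (spinEmbed (spinToTorusEmb Lj hj) D) =
        K.groundStateFunctional (Xᴴ * (K * X - X * K)) := by
      rw [← hkey, map_sub, map_smul, smul_eq_mul]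
    rw [hval]
    exact groundStateFunctional_conjTranspose_comm_mul_nonneg (sourcedAF_isHermitian n J 1 α (B m)) X
  -- Step B: `B_m ω_m(D) → 0` and `ω_m(C) → ω(C)`
  have hbd : ∀ m, ‖(ωB m).expect Λ' D‖ ≤ ‖D‖ := fun m => (ωB m).norm_expect_le_holds Λ' D
  have hBD : Tendsto (fun m => (B m : ℂ) * (ωB m).expect Λ' D) atTop (𝓝 0) := by
    have hB0' : Tendsto (fun m => (B m : ℂ)) atTop (𝓝 0) := by
      have := Complex.continuous_ofReal.tendsto 0
      rw [Complex.ofReal_zero] at this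
      exact this.comp hB0
    refine squeeze_zero_norm (a := fun m => ‖(B m : ℂ)‖ * ‖D‖) (fun m => ?_) ?_
    · rw [norm_mul]; exact mul_le_mul_of_nonneg_left (hbd m) (norm_nonneg _)
    · simpa using hB0'.norm.mul_const ‖D‖
  have hT : Tendsto (fun m => (ωB m).expect Λ' C - (B m : ℂ) * (ωB m).expect Λ' D) atTop
      (𝓝 (ω.expect Λ' C)) := by
    simpa using (hlim Λ' C).sub hBD
  exact ge_of_tendsto' hT hstep

/-- **THERE IS AN INFINITE-VOLUME GROUND STATE OF THE HEISENBERG ANTIFERROMAGNET ON `ℤ^d` WITH NÉEL ORDER**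
(`J > 0`, `d ≥ 2`, `S = n/2 ≥ ½`, `(d, S) ≠ (2, ½)` — exactly where the tree proves ground-state long-range order):
there are `σ > 0` and an infinite-volume state `ω` of the spin-`n/2` system on `ℤ^d` which (i) is a ground state of
the Heisenberg interaction in the sense of Bratteli–Robinson (`ω ∈ groundStates (heisenbergLatticeInteraction d n J) 1`),
(ii) is invariant under the even translations of `ℤ^d`, and (iii) has spontaneous staggered magnetisation
`(-1)^x Re ω(Sˣ_x) ≥ √3 σ` at EVERY site (the same value at every site).  [`ω` = an infinitesimal-field ground
state of KT93 (1.8); `σ` = the KLS / KT93 §7 long-range order parameter.]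
[cite: KomaTasaki1993, §1 Corollary 1.1 and (1.8)–(1.10), §7 Cor. 7.2] [cite: KennedyLiebShastryJSP1988, Theorem]
[cite: Tasaki2020, App. A.7 Lemma A.15] -/
theorem heisenbergAF_exists_groundState_neelOrder (hd : 2 ≤ d) {n : ℕ} (hn : 1 ≤ n) (hdn : ¬ (d = 2 ∧ n = 1))
    {J : ℝ} (hJ : 0 < J) :
    ∃ σ : ℝ, 0 < σ ∧ ∃ ω : InfVolState d (n + 1),
      ω ∈ groundStates (heisenbergLatticeInteraction d n J) 1 ∧
      (∀ v : Site d, latticeStagger v = 1 → ω.shift v = ω) ∧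
      (∀ x y : Site d, latticeStagger x * (ω.expect {x} (siteSpinAt n x 0)).re =
        latticeStagger y * (ω.expect {y} (siteSpinAt n y 0)).re) ∧
      ∀ x : Site d, Real.sqrt 3 * σ ≤ latticeStagger x * (ω.expect {x} (siteSpinAt n x 0)).re := by
  obtain ⟨σ, hσ, -, hfloor⟩ := heisenbergAF_infiniteVolume_groundState_spontaneousStaggeredMagnetisation hd hn hdn hJ
  obtain ⟨ω, hω⟩ := exists_isInfinitesimalFieldGroundState (d := d) (n := n) J 1 0
  obtain ⟨hshift, hconst⟩ := hω.shift_eq_and_stagMagnetisation_eq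
  exact ⟨σ, hσ, ω, hω.isGroundState, hshift, hconst, hfloor ω hω⟩

/-! ### Non-uniqueness: the Néel ground state is not translation invariant -/

/-- **Translating a one-site expectation**: `(ω ∘ τ_v)(S^α_x) = ω(S^α_{x+v})`.
[cite: BratteliRobinsonII1997, §6.2.1 eq. (6.2.2)] -/
theorem _root_.Literature.MathematicalPhysics.QuantumLattice.InfVolState.shift_expect_siteSpinAt {n : ℕ}
    (ω : InfVolState d (n + 1)) (v x : Site d) (α : Fin 3) :
    (ω.shift v).expect {x} (siteSpinAt n x α) = ω.expect {x + v} (siteSpinAt n (x + v) α) := by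
  have h : ({x} : Finset (Site d)).map (Site.shift v).toEmbedding ⊆ {x + v} := by simp
  rw [InfVolState.shift_expect, ← ω.compatible h, siteSpinAt, transportOp_eq_reindexOp, reindexOp_siteSpin,
    embedOp_siteSpin]
  congr 2

/-- **The Néel sign alternates along every bond of `ℤ^d`**: `(-1)^{x + eᵢ} = -(-1)^x` (via the even torus
`(ℤ/2ℤ)^d`; the tree's `latticeStagger_add_single'` lives in an unbuilt module). [cite: DLS1978, §1] -/
theorem latticeStagger_add_unitVec (x : Site d) (i : Fin d) : latticeStagger (x + unitVec i) = -latticeStagger x := by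
  have h2 : Even 2 := even_two
  have hu : latticeStagger (unitVec i : Site d) = -1 := by
    rw [latticeStagger_apply]
    have hs : ∑ j, ((unitVec i : Site d) j).natAbs = 1 := by
      rw [Finset.sum_eq_single i (fun j _ hj => by simp [unitVec, Pi.single_eq_of_ne hj]) (by simp)]
      simp [unitVec]
    rw [hs, pow_one]
  rw [← stagSign_torusParityExp_proj (L := 2) h2, proj_add_eq_torusAff, torusAff_one, Equiv.coe_addRight,
    stagSign_torusParityExp_add h2, stagSign_torusParityExp_proj h2, stagSign_torusParityExp_proj h2, hu,
    mul_neg_one]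

/-- **THE HEISENBERG ANTIFERROMAGNET ON `ℤ^d` DOES NOT HAVE A UNIQUE INFINITE-VOLUME GROUND STATE**
(`J > 0`, `d ≥ 2`, `S = n/2 ≥ ½`, `(d, S) ≠ (2, ½)`): a unique ground state of a translation-invariant
interaction is translation invariant (tree `HasUniqueGroundState.shift_eq`, Tasaki 2022 §3.2), but the Néel
ground state of `heisenbergAF_exists_groundState_neelOrder` has staggered magnetisation `(-1)^x Re ω(Sˣ_x) ≥ √3σ > 0`
of constant sign, which a translation by one lattice step would reverse.  (Spontaneous breaking of the
`SU(2)` and translation symmetry in the ground state; Koma–Tasaki 1994 §1, Tasaki 2020 §4.4.)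
[cite: KomaTasaki1994, §1] [cite: KomaTasaki1993, Corollary 1.1] [cite: Tasaki2020, §4.4] -/
theorem heisenbergAF_not_hasUniqueGroundState (hd : 2 ≤ d) {n : ℕ} (hn : 1 ≤ n) (hdn : ¬ (d = 2 ∧ n = 1))
    {J : ℝ} (hJ : 0 < J) : ¬ HasUniqueGroundState (heisenbergLatticeInteraction d n J) 1 := by
  intro hU
  obtain ⟨σ, hσ, ω, hgs, -, hconst, hfloor⟩ := heisenbergAF_exists_groundState_neelOrder hd hn hdn hJ
  set i₀ : Fin d := ⟨0, by omega⟩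
  have hshift := hU.shift_eq (isTranslationInvariant_heisenbergLatticeInteraction n J) hgs (unitVec i₀)
  -- `ω(Sˣ_0) = ω(Sˣ_{e₀})` by translation invariance, but the Néel signs are opposite
  have h0 : (ω.expect {(0 : Site d)} (siteSpinAt n 0 0)) =
      ω.expect {(0 : Site d) + unitVec i₀} (siteSpinAt n ((0 : Site d) + unitVec i₀) 0) := by
    rw [← InfVolState.shift_expect_siteSpinAt ω (unitVec i₀) 0 0, hshift]
  have h1 := hconst 0 ((0 : Site d) + unitVec i₀)
  rw [latticeStagger_add_unitVec, latticeStagger_zero, ← h0, one_mul, neg_one_mul] at h1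
  have h2 := hfloor 0
  rw [latticeStagger_zero, one_mul] at h2
  have h3 : (0 : ℝ) < Real.sqrt 3 * σ := mul_pos (Real.sqrt_pos.2 (by norm_num)) hσ
  linarith

end XXZKT

end Literature.MathematicalPhysics.QuantumLattice

end
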